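/-
Copyright (c) 2026 the pub-hodgecm-mathlib formalisation cell (harness21).  Prover seat hodgecm-mathlib-K2-defs1 (g7), K2 currency desk ∕ R90-TF currency chair; junction
J-S2-S8-1 (R90-CS-typ1 F3 «`#synth Nonempty R90.S2.ArchPktLabel` fails»; R90-CS-plan 16:30:13Z (c) RECOMMENDED FIX «a new 10-line ★ leaf, ★ `R90S2ArchKitDefs` bytes untouched»).
-/
import Summits.HodgeConjecture.HodgeConjecture.Theorems.R90S2ArchKitDefs   -- ★ `R90.S2.ArchPktLabel` (`.aPair s q`, `.ds a b c h`), ★ `R90.S2.rogawskiArchKit` (`PktInf := ArchPktLabel`, `rogawskiArchKit_PktInf` rfl)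
import HarnessLib

/-!
# `Nonempty` ∕ `Inhabited` instances for the S2 archimedean packet labels `R90.S2.ArchPktLabel` = `rogawskiArchKit.PktInf`

Cell `pub/hodgecm-mathlib`, crux H413 = `stmt-HodgeConjecture-24833`; R90-TF programme, junction J-S2-S8-1.  The S5 export `infOfOfRecord` (file C) and the O1″∕(T)
consumers carry an instance binder `[Nonempty 𝔞.PktInf]`; at the archimedean kit OF RECORD `𝔞 := ★ R90.S2.rogawskiArchKit` (whose `PktInf` is the `Type 0`
inductive ★ `ArchPktLabel`, ★ `rogawskiArchKit_PktInf : rogawskiArchKit.PktInf = ArchPktLabel := rfl`) that binder must be found by instance search, and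
★ `R90S2ArchKitDefs` declares none (R90-CS-typ1 probe F3).  This leaf supplies the instances ONCE (witness: the A-packet label `.aPair 0 0`), so that no consumer
writes a local `haveI` (C3: consumer bytes stay identical) and the ★ defs file's bytes stay untouched (L9).  Instances in a `Theorems/` leaf are the cell's
practice (the no-`instance` lint concerns Literature statement∕port files); they assert no mathematics beyond «the label type is inhabited».
HONEST LABEL: HC_CM is proved only modulo the 7 printed citations (2 remaining named inputs: hLiu418 = `stmt-HodgeConjecture-24832`, h413 = `stmt-HodgeConjecture-24833`)
until rung 0 closes; instances only, count-neutral, closes no socket.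
-/

set_option autoImplicit false
-- the mandated namespace repeats the single-problem summit's segment (`HodgeConjecture.HodgeConjecture`)
set_option linter.dupNamespace false

namespace Summit.HodgeConjecture.HodgeConjecture.R90.S2

/-- The archimedean packet labels are inhabited (witness: the A-packet label `aPair 0 0`). [cite: Rogawski1990, §12.3 p. 178] -/
instance instInhabitedArchPktLabel : Inhabited ArchPktLabel := ⟨.aPair 0 0⟩

/-- `Nonempty ArchPktLabel` (from the `Inhabited` instance; stated so that `#synth Nonempty R90.S2.ArchPktLabel` succeeds by name). [cite: Rogawski1990, §12.3 p. 178] -/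
instance instNonemptyArchPktLabel : Nonempty ArchPktLabel := ⟨.aPair 0 0⟩

/-- `Nonempty rogawskiArchKit.PktInf` — the binder `[Nonempty 𝔞.PktInf]` of the S5∕S7 consumers at the kit of record (`PktInf := ArchPktLabel` by `rfl`,
★ `rogawskiArchKit_PktInf`). [cite: Rogawski1990, §12.3 p. 178] -/
instance instNonemptyRogawskiArchKitPktInf : Nonempty rogawskiArchKit.PktInf := ⟨ArchPktLabel.aPair 0 0⟩

/-- `Inhabited rogawskiArchKit.PktInf` (default label `aPair 0 0`). [cite: Rogawski1990, §12.3 p. 178] -/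
instance instInhabitedRogawskiArchKitPktInf : Inhabited rogawskiArchKit.PktInf := ⟨ArchPktLabel.aPair 0 0⟩

/-- Read-back: instance search now finds `Nonempty rogawskiArchKit.PktInf`. [cite: Rogawski1990, §12.3 p. 178] -/
theorem nonempty_rogawskiArchKit_PktInf : Nonempty rogawskiArchKit.PktInf := inferInstance

end Summit.HodgeConjecture.HodgeConjecture.R90.S2
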